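import Mathlib
import Summits.AtomisticToContinuum.HydrodynamicLimit.Theorems.ImplosionDichotomyDenseExcursionCavityNegExpVolterra

/-!
# The Volterra fixed point behind the smooth branch of a first-kind singular system with a vector-valued regular row
# (crux `DenseExcursion`, line `sonic-cavity-renewal`, brick for stub `stub_cavityResolventCk`, theorem T6 at the
# jet resonances)

Helper file (`--supports stmt-AtomisticToContinuum-12586`, line lead a2, stub-worker E2 for `stub_cavityResolventCk`).
Vector-valued generalisation of `negexp_volterra_fixed_point` (`…CavityNegExpVolterra`, scalar regular row): for a
complex Banach space `E`, `a ∈ ℂ` with `Re a ≥ 0`, a continuous nowhere-vanishing `μ : ℝ → ℂ`, continuous coefficient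
fields `a₁₂ : ℝ → (E →L[ℂ] ℂ)`, `a₂₁ : ℝ → E`, `a₂₂ : ℝ → (E →L[ℂ] E)` there is `δ > 0` such that for all continuous
sources `b₁ : ℝ → ℂ`, `b₂ : ℝ → E` and every `c₀ : E` there are CONTINUOUS `u : ℝ → ℂ`, `c : ℝ → E` with

  `u(R) = μ(R) ∫₀¹ t^a ((a₁₂ c + b₁)/μ)(Rt) dt`  (all `R`),   `c(R) = c₀ + ∫₀ᴿ (u • a₂₁ + a₂₂ c + b₂)`  (`|R| ≤ δ`)

(registered helper `res_volterra_fixed_point`). This is the integral form of the system `R u′ = a₁₁ u + a₁₂(c) + b₁`,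
`c′ = u • a₂₁ + a₂₂(c) + b₂` with `a₁₁(0) = ν`, `Re ν ≤ −1`, `a = −ν − 1`, after the integrating factor has conjugated
the `u`-row to the Euler row `R ũ′ = ν ũ + h`. The vector-valued regular row is what the REDUCTION OF A JET RESONANCE
`ν = m ∈ ℕ` BY `m + 1` DIFFERENTIATIONS produces (the differentiated unknowns `u, u′, …, u⁽ᵐ⁾, c` become regular
unknowns, `u⁽ᵐ⁺¹⁾` is singular with exponent `−1`). Proof verbatim from the scalar file: `c ↦ Φ(c)` is a
`1/2`-contraction of `C([−δ, δ], E)` for `δ` small (operator norms replace absolute values), Banach's fixed point theorem.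
Sources: folklore (Volterra integral equations; Coddington–Levinson 1955 Ch. 4 §2).
-/

noncomputable section

open Set Filter MeasureTheory intervalIntegral
open scoped Topology NNReal

namespace Summit.AtomisticToContinuum.HydrodynamicLimit.Theorems.SonicCavityRenewal

/-- **Registered helper `res_volterra_fixed_point`: THE VOLTERRA FIXED POINT OF THE SMOOTH BRANCH OF A FIRST-KIND
SINGULAR SYSTEM WITH A VECTOR-VALUED REGULAR ROW (exponent `Re ν ≤ −1`).** See the module docstring. [folklore] -/
theorem res_volterra_fixed_point : ∀ (E : Type) [NormedAddCommGroup E] [NormedSpace ℂ E] [CompleteSpace E] (a : ℂ) (μ : ℝ → ℂ) (a₁₂ : ℝ → E →L[ℂ] ℂ) (a₂₁ : ℝ → E) (a₂₂ : ℝ → E →L[ℂ] E), 0 ≤ a.re → Continuous μ → (∀ R, μ R ≠ 0) → Continuous a₁₂ → Continuous a₂₁ → Continuous a₂₂ → ∃ δ : ℝ, 0 < δ ∧ ∀ (b₁ : ℝ → ℂ) (b₂ : ℝ → E), Continuous b₁ → Continuous b₂ → ∀ c₀ : E, ∃ (u : ℝ → ℂ) (c : ℝ → E), Continuous u ∧ Continuous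 c ∧ (∀ R, u R = μ R * ∫ t in (0 : ℝ)..1, (t : ℂ) ^ a * ((a₁₂ (R * t) (c (R * t)) + b₁ (R * t)) / μ (R * t))) ∧ (∀ R ∈ Set.Icc (-δ) δ, c R = c₀ + ∫ s in (0 : ℝ)..R, (u s • a₂₁ s + a₂₂ s (c s) + b₂ s)) := by
  intro E _ _ _ a μ a₁₂ a₂₁ a₂₂ ha hμ hμ0 ha₁₂ ha₂₁ ha₂₂
  -- constants on `[-1, 1]`
  have hK : IsCompact (Icc (-1 : ℝ) 1) := isCompact_Icc
  obtain ⟨A, hA⟩ := hK.exists_bound_of_continuousOn ha₁₂.continuousOn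
  obtain ⟨B, hB⟩ := hK.exists_bound_of_continuousOn ha₂₁.continuousOn
  obtain ⟨D, hD⟩ := hK.exists_bound_of_continuousOn ha₂₂.continuousOn
  obtain ⟨M, hM⟩ := hK.exists_bound_of_continuousOn hμ.continuousOn
  obtain ⟨x₀, hx₀, hmin⟩ := hK.exists_isMinOn (nonempty_Icc.2 (by norm_num)) (continuous_norm.comp hμ).continuousOn
  set μ₀ : ℝ := ‖μ x₀‖ with hμ₀
  have hμ₀pos : 0 < μ₀ := norm_pos_iff.2 (hμ0 x₀)
  have hμ₀le : ∀ s ∈ Icc (-1 : ℝ) 1, μ₀ ≤ ‖μ s‖ := fun s hs => hmin hs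
  have hA0 : 0 ≤ A := (norm_nonneg _).trans (hA 0 (by norm_num))
  have hB0 : 0 ≤ B := (norm_nonneg _).trans (hB 0 (by norm_num))
  have hD0 : 0 ≤ D := (norm_nonneg _).trans (hD 0 (by norm_num))
  have hM0 : 0 ≤ M := (norm_nonneg _).trans (hM 0 (by norm_num))
  -- Lipschitz constant of `c ↦ K c` and the radius
  set L₁ : ℝ := M * (A / μ₀) with hL₁
  have hL₁0 : 0 ≤ L₁ := by positivity
  set δ : ℝ := min 1 (1 / (2 * (B * L₁ + D) + 2)) with hδ
  have hδpos : 0 < δ := lt_min one_pos (by positivity)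
  have hδ1 : δ ≤ 1 := min_le_left _ _
  have hδL : δ * (B * L₁ + D) ≤ 1 / 2 := by
    have h1 : δ ≤ 1 / (2 * (B * L₁ + D) + 2) := min_le_right _ _
    have h2 : 0 < 2 * (B * L₁ + D) + 2 := by positivity
    have h3 : δ * (2 * (B * L₁ + D) + 2) ≤ 1 := by
      rw [le_div_iff₀ h2] at h1; exact h1
    nlinarith [mul_nonneg hδpos.le (by positivity : (0 : ℝ) ≤ B * L₁ + D)]
  refine ⟨δ, hδpos, fun b₁ b₂ hb₁ hb₂ c₀ => ?_⟩
  have hI : (-δ : ℝ) ≤ δ := by linarith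
  haveI : CompactSpace (Icc (-δ) δ) := isCompact_iff_compactSpace.1 isCompact_Icc
  haveI : Nonempty (Icc (-δ) δ) := ⟨⟨0, by constructor <;> linarith⟩⟩
  -- the operators on plain functions
  let ext : C(Icc (-δ) δ, E) → ℝ → E := fun c => IccExtend hI c
  let Kf : C(Icc (-δ) δ, E) → ℝ → ℂ := fun c R =>
    μ R * ∫ t in (0 : ℝ)..1, (t : ℂ) ^ a * ((a₁₂ (R * t) (ext c (R * t)) + b₁ (R * t)) / μ (R * t))
  let Pf : C(Icc (-δ) δ, E) → ℝ → E := fun c R =>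
    c₀ + ∫ s in (0 : ℝ)..R, (Kf c s • a₂₁ s + a₂₂ s (ext c s) + b₂ s)
  have hext : ∀ c, Continuous (ext c) := fun c => c.continuous.Icc_extend'
  have hinner : ∀ c, Continuous fun s => (a₁₂ s (ext c s) + b₁ s) / μ s := fun c =>
    ((ha₁₂.clm_apply (hext c)).add hb₁).div hμ hμ0
  have hKc : ∀ c, Continuous (Kf c) := fun c => hμ.mul (continuous_eulerCpow ha (hinner c))
  have hPi : ∀ c, Continuous fun s => Kf c s • a₂₁ s + a₂₂ s (ext c s) + b₂ s := fun c =>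
    (((hKc c).smul ha₂₁).add (ha₂₂.clm_apply (hext c))).add hb₂
  have hPc : ∀ c, Continuous (Pf c) := fun c =>
    continuous_const.add (intervalIntegral.continuous_primitive (fun a b => (hPi c).intervalIntegrable a b) 0)
  -- the self-map of `C([−δ, δ], E)`
  let Φ : C(Icc (-δ) δ, E) → C(Icc (-δ) δ, E) := fun c => ⟨fun R => Pf c R, (hPc c).comp continuous_subtype_val⟩
  -- pointwise Lipschitz estimates
  have hextd : ∀ (c c' : C(Icc (-δ) δ, E)) (s : ℝ), ‖ext c s - ext c' s‖ ≤ dist c c' := by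
    intro c c' s
    simp only [ext, IccExtend, Function.comp_apply, ← dist_eq_norm]
    exact ContinuousMap.dist_apply_le_dist _
  have hmemI : ∀ {s : ℝ}, |s| ≤ δ → s ∈ Icc (-1 : ℝ) 1 := fun hs =>
    ⟨by linarith [(abs_le.1 hs).1], by linarith [(abs_le.1 hs).2]⟩
  have hKd : ∀ (c c' : C(Icc (-δ) δ, E)) (R : ℝ), |R| ≤ δ → ‖Kf c R - Kf c' R‖ ≤ L₁ * dist c c' := by
    intro c c' R hR
    have hRI := hmemI hR
    have hi : ∀ c : C(Icc (-δ) δ, E), IntervalIntegrable (fun t : ℝ =>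
        (t : ℂ) ^ a * ((a₁₂ (R * t) (ext c (R * t)) + b₁ (R * t)) / μ (R * t))) volume 0 1 := fun c =>
      intervalIntegrable_eulerCpow ha (hinner c) R
    have hdiff : Kf c R - Kf c' R = μ R * ∫ t in (0 : ℝ)..1, (t : ℂ) ^ a *
        ((a₁₂ (R * t) (ext c (R * t) - ext c' (R * t))) / μ (R * t)) := by
      have hsub := intervalIntegral.integral_sub (hi c) (hi c')
      have heq : (∫ t in (0 : ℝ)..1, ((t : ℂ) ^ a * ((a₁₂ (R * t) (ext c (R * t)) + b₁ (R * t)) / μ (R * t)) -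
          (t : ℂ) ^ a * ((a₁₂ (R * t) (ext c' (R * t)) + b₁ (R * t)) / μ (R * t)))) =
          ∫ t in (0 : ℝ)..1, (t : ℂ) ^ a * ((a₁₂ (R * t) (ext c (R * t) - ext c' (R * t))) / μ (R * t)) :=
        integral_congr fun t _ => by rw [map_sub]; ring
      simp only [Kf]
      rw [← mul_sub, ← hsub, heq]
    rw [hdiff, norm_mul]
    have hbound : ∀ s, |s| ≤ |R| → ‖(a₁₂ s (ext c s - ext c' s)) / μ s‖ ≤ A / μ₀ * dist c c' := by
      intro s hs
      have hsI := hmemI (hs.trans hR)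
      rw [norm_div, div_eq_mul_inv]
      have h1 : ‖a₁₂ s (ext c s - ext c' s)‖ ≤ A * dist c c' :=
        (ContinuousLinearMap.le_opNorm _ _).trans (mul_le_mul (hA s hsI) (hextd c c' s) (norm_nonneg _) hA0)
      have h3 : (‖μ s‖)⁻¹ ≤ μ₀⁻¹ := inv_anti₀ hμ₀pos (hμ₀le s hsI)
      calc ‖a₁₂ s (ext c s - ext c' s)‖ * (‖μ s‖)⁻¹ ≤ A * dist c c' * μ₀⁻¹ := by
            gcongr
        _ = A / μ₀ * dist c c' := by ring
    have hint := norm_eulerCpow_le ha (g := fun s => (a₁₂ s (ext c s - ext c' s)) / μ s) (R := R) hbound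
    calc ‖μ R‖ * ‖∫ t in (0 : ℝ)..1, (t : ℂ) ^ a * ((a₁₂ (R * t) (ext c (R * t) - ext c' (R * t))) / μ (R * t))‖
        ≤ M * (A / μ₀ * dist c c') := mul_le_mul (hM R hRI) hint (norm_nonneg _) hM0
      _ = L₁ * dist c c' := by rw [hL₁]; ring
  have hPd : ∀ (c c' : C(Icc (-δ) δ, E)) (R : ℝ), |R| ≤ δ → ‖Pf c R - Pf c' R‖ ≤ 1 / 2 * dist c c' := by
    intro c c' R hR
    have hdiff : Pf c R - Pf c' R =
        ∫ s in (0 : ℝ)..R, ((Kf c s - Kf c' s) • a₂₁ s + a₂₂ s (ext c s - ext c' s)) := by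
      simp only [Pf]
      rw [add_sub_add_left_eq_sub, ← intervalIntegral.integral_sub ((hPi c).intervalIntegrable _ _)
        ((hPi c').intervalIntegrable _ _)]
      refine integral_congr fun s _ => ?_
      simp only [sub_smul, map_sub]
      abel
    rw [hdiff]
    have hb : ∀ s ∈ Set.uIoc (0 : ℝ) R, ‖(Kf c s - Kf c' s) • a₂₁ s + a₂₂ s (ext c s - ext c' s)‖ ≤
        (B * L₁ + D) * dist c c' := by
      intro s hs
      have hs' : |s| ≤ |R| := by
        rcases le_or_gt 0 R with h | h
        · rw [uIoc_of_le h] at hs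
          rw [abs_of_nonneg hs.1.le, abs_of_nonneg h]; exact hs.2
        · rw [uIoc_of_ge h.le] at hs
          rw [abs_of_nonpos hs.2, abs_of_neg h]; linarith [hs.1]
      have hsδ : |s| ≤ δ := hs'.trans hR
      have hsI := hmemI hsδ
      calc ‖(Kf c s - Kf c' s) • a₂₁ s + a₂₂ s (ext c s - ext c' s)‖
          ≤ ‖Kf c s - Kf c' s‖ * ‖a₂₁ s‖ + ‖a₂₂ s‖ * ‖ext c s - ext c' s‖ := by
            refine (norm_add_le _ _).trans (add_le_add ?_ (ContinuousLinearMap.le_opNorm _ _))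
            rw [norm_smul]
        _ ≤ L₁ * dist c c' * B + D * dist c c' :=
            add_le_add (mul_le_mul (hKd c c' s hsδ) (hB s hsI) (norm_nonneg _) (by positivity))
              (mul_le_mul (hD s hsI) (hextd c c' s) (norm_nonneg _) hD0)
        _ = (B * L₁ + D) * dist c c' := by ring
    calc ‖∫ s in (0 : ℝ)..R, ((Kf c s - Kf c' s) • a₂₁ s + a₂₂ s (ext c s - ext c' s))‖
        ≤ (B * L₁ + D) * dist c c' * |R - 0| := norm_integral_le_of_norm_le_const hb
      _ ≤ (B * L₁ + D) * dist c c' * δ := by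
          rw [sub_zero]; exact mul_le_mul_of_nonneg_left hR (by positivity)
      _ ≤ 1 / 2 * dist c c' := by nlinarith [hδL, dist_nonneg (x := c) (y := c')]
  -- contraction
  have hΦ : ContractingWith (1 / 2 : ℝ≥0) Φ := by
    refine ⟨by norm_num, LipschitzWith.of_dist_le_mul fun c c' => ?_⟩
    rw [ContinuousMap.dist_le (by positivity)]
    rintro ⟨R, hR⟩
    have hR' : |R| ≤ δ := abs_le.2 hR
    have h := hPd c c' R hR'
    rw [dist_eq_norm]
    have e : ((1 / 2 : ℝ≥0) : ℝ) = 1 / 2 := by norm_num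
    rw [e]
    exact h
  set cst := ContractingWith.fixedPoint Φ hΦ with hcst
  have hfix : Φ cst = cst := hΦ.fixedPoint_isFixedPt
  have hcst : ∀ R (hR : R ∈ Icc (-δ) δ), cst ⟨R, hR⟩ = Pf cst R := fun R hR =>
    calc cst ⟨R, hR⟩ = (Φ cst) ⟨R, hR⟩ := by rw [hfix]
      _ = Pf cst R := rfl
  refine ⟨Kf cst, ext cst, hKc cst, hext cst, fun R => rfl, fun R hR => ?_⟩
  exact (IccExtend_of_mem hI cst hR).trans (hcst R hR)

end Summit.AtomisticToContinuum.HydrodynamicLimit.Theorems.SonicCavityRenewal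

end
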